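import Literature.Analysis.FluidPDE.StationaryEulerLaminates
import Literature.Analysis.FluidPDE.StationaryEulerPotentials
import HarnessLib

/-!
# Planar states in coordinates (Choffrut–Székelyhidi 2014, §5.1)

Topic `Literature/Analysis/FluidPDE`. Support file of the proof of
`Literature.Analysis.FluidPDE.Torus.ChoffrutSzekelyhidi2014_thm1` (Choffrut–Székelyhidi, SIAM
J. Math. Anal. 46 (2014) = arXiv:1401.4301), §5.1 "Suitable coordinates in state-space" for
`d = 2`: with the two indices `i₀ ≠ i₁` of `d` (a `Frame2`), an admissible state
`w = (v, u) ∈ ℝ² × 𝒮²₀` is `v = (a, b)`, `u = [[c, e], [e, -c]]` (the paper's `z = a + ib`,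
`ζ = c + ie`); the constructor `mk4 a b c e`, the coordinate form of `𝒦_r`
(`𝒦_r = {|z|² = r, ζ = z²/2}`), a sufficient `2 × 2` criterion for `𝒦_r^{co}`, the rotations
`R_θ : (z, ζ) ↦ (z e^{iθ}, ζ e^{2iθ})` ((5.1) of the paper) written with `(κ, λ) = (cos θ, sin θ)`,
and the wave-cone directions used by the planar laminates (Lemma 13: horizontal directions and
the directions `(σ√r, 0, r)`, `(0, σ√r, -r)` of (5.5)–(5.6), rotated).

## References

* A. Choffrut, L. Székelyhidi Jr., SIAM J. Math. Anal. 46 (2014), §5.1, Lemma 13, (5.1).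
-/

noncomputable section

open scoped InnerProductSpace Matrix
open Set Function

namespace Literature.Analysis.FluidPDE

namespace StationaryEuler

variable {d : Type*} [Fintype d] [DecidableEq d]

/-! ## Two indices -/

/-- The two indices of a two-element index type. [folklore] -/
structure Frame2 (d : Type*) [Fintype d] where
  /-- the first index -/
  i₀ : d
  /-- the second index -/
  i₁ : d
  ne : i₀ ≠ i₁
  univ : ∀ i, i = i₀ ∨ i = i₁

namespace Frame2

omit [DecidableEq d] in
/-- A type with two elements has a `Frame2`. [folklore] -/
theorem nonempty_of_card (h : Fintype.card d = 2) : Nonempty (Frame2 d) := by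
  classical
  have h' : (Finset.univ : Finset d).card = 2 := by rw [Finset.card_univ, h]
  obtain ⟨x, y, hxy, huniv⟩ := Finset.card_eq_two.1 h'
  refine ⟨⟨x, y, hxy, fun i => ?_⟩⟩
  have : i ∈ ({x, y} : Finset d) := by rw [← huniv]; exact Finset.mem_univ i
  simpa using this

variable (φ : Frame2 d)

omit [DecidableEq d] in
/-- `i₁ ≠ i₀`. [folklore] -/
theorem ne' : φ.i₁ ≠ φ.i₀ := φ.ne.symm

/-- The universe is `{i₀, i₁}`. [folklore] -/
theorem univ_eq : (Finset.univ : Finset d) = {φ.i₀, φ.i₁} := by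
  ext i; simp only [Finset.mem_univ, Finset.mem_insert, Finset.mem_singleton, true_iff]; exact φ.univ i

/-- Sums over `d` have two terms. [folklore] -/
theorem sum_eq {M : Type*} [AddCommMonoid M] (f : d → M) : ∑ i, f i = f φ.i₀ + f φ.i₁ := by
  rw [φ.univ_eq, Finset.sum_pair φ.ne]

omit [DecidableEq d] in
/-- Universal statements over `d` have two instances. [folklore] -/
theorem forall_iff {P : d → Prop} : (∀ i, P i) ↔ P φ.i₀ ∧ P φ.i₁ :=
  ⟨fun h => ⟨h _, h _⟩, fun h i => by rcases φ.univ i with rfl | rfl <;> [exact h.1; exact h.2]⟩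

/-- `Fintype.card d = 2`. [folklore] -/
theorem card_eq (φ : Frame2 d) : Fintype.card d = 2 := by
  rw [← Finset.card_univ, φ.univ_eq, Finset.card_pair φ.ne]

/-! ## Coordinates and the constructor -/

/-- The vector `(a, b)`. [folklore] -/
def vec2 (a b : ℝ) : Ed d := WithLp.toLp 2 fun i => if i = φ.i₀ then a else b

/-- The symmetric trace-free matrix `[[c, e], [e, -c]]`. [folklore] -/
def mat2 (c e : ℝ) : Matrix d d ℝ :=
  Matrix.of fun i j => if i = φ.i₀ then (if j = φ.i₀ then c else e) else (if j = φ.i₀ then e else -c)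

/-- First coordinate of `vec2`. [folklore] -/
@[simp] theorem vec2_apply₀ (a b : ℝ) : φ.vec2 a b φ.i₀ = a := by simp [vec2]
/-- Second coordinate of `vec2`. [folklore] -/
@[simp] theorem vec2_apply₁ (a b : ℝ) : φ.vec2 a b φ.i₁ = b := by simp [vec2, φ.ne']
/-- Entry `(0,0)` of `mat2`. [folklore] -/
@[simp] theorem mat2_apply₀₀ (c e : ℝ) : φ.mat2 c e φ.i₀ φ.i₀ = c := by simp [mat2]
/-- Entry `(0,1)` of `mat2`. [folklore] -/
@[simp] theorem mat2_apply₀₁ (c e : ℝ) : φ.mat2 c e φ.i₀ φ.i₁ = e := by simp [mat2, φ.ne']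
/-- Entry `(1,0)` of `mat2`. [folklore] -/
@[simp] theorem mat2_apply₁₀ (c e : ℝ) : φ.mat2 c e φ.i₁ φ.i₀ = e := by simp [mat2, φ.ne']
/-- Entry `(1,1)` of `mat2`. [folklore] -/
@[simp] theorem mat2_apply₁₁ (c e : ℝ) : φ.mat2 c e φ.i₁ φ.i₁ = -c := by simp [mat2, φ.ne']

/-- **The planar state** `(z, ζ) = (a + ib, c + ie)`: velocity `(a, b)`, stress `[[c, e], [e, -c]]`.
[cite: ChoffrutSzekelyhidi2014, §5.1] -/
def mk4 (a b c e : ℝ) : State d := mkSt (φ.vec2 a b) (φ.mat2 c e)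

/-- Velocity of `mk4`. [folklore] -/
@[simp] theorem vel_mk4 (a b c e : ℝ) : vel (φ.mk4 a b c e) = φ.vec2 a b := vel_mkSt _ _
/-- Stress of `mk4`. [folklore] -/
@[simp] theorem str_mk4 (a b c e : ℝ) : str (φ.mk4 a b c e) = φ.mat2 c e := str_mkSt _ _

/-- The four coordinates of a state. [folklore] -/
def ca (w : State d) : ℝ := vel w φ.i₀
/-- The second velocity coordinate. [folklore] -/
def cb (w : State d) : ℝ := vel w φ.i₁
/-- The diagonal stress coordinate. [folklore] -/
def cc (w : State d) : ℝ := str w φ.i₀ φ.i₀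
/-- The off-diagonal stress coordinate. [folklore] -/
def ce (w : State d) : ℝ := str w φ.i₀ φ.i₁

/-- `a`-coordinate of `mk4`. [folklore] -/
@[simp] theorem ca_mk4 (a b c e : ℝ) : φ.ca (φ.mk4 a b c e) = a := by rw [ca, vel_mk4, vec2_apply₀]
/-- `b`-coordinate of `mk4`. [folklore] -/
@[simp] theorem cb_mk4 (a b c e : ℝ) : φ.cb (φ.mk4 a b c e) = b := by rw [cb, vel_mk4, vec2_apply₁]
/-- `c`-coordinate of `mk4`. [folklore] -/
@[simp] theorem cc_mk4 (a b c e : ℝ) : φ.cc (φ.mk4 a b c e) = c := by rw [cc, str_mk4, mat2_apply₀₀]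
/-- `e`-coordinate of `mk4`. [folklore] -/
@[simp] theorem ce_mk4 (a b c e : ℝ) : φ.ce (φ.mk4 a b c e) = e := by rw [ce, str_mk4, mat2_apply₀₁]

/-- `mk4` is additive. [folklore] -/
theorem mk4_add (a b c e a' b' c' e' : ℝ) :
    φ.mk4 a b c e + φ.mk4 a' b' c' e' = φ.mk4 (a + a') (b + b') (c + c') (e + e') := by
  rw [← mkSt_vel_str (φ.mk4 a b c e + φ.mk4 a' b' c' e'), vel_add, str_add, vel_mk4, vel_mk4, str_mk4, str_mk4, mk4]
  congr 1
  · ext i; rcases φ.univ i with rfl | rfl <;> simp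
  · ext i j
    rcases φ.univ i with rfl | rfl <;> rcases φ.univ j with rfl | rfl <;> simp
    ring

/-- `mk4` is homogeneous. [folklore] -/
theorem smul_mk4 (t a b c e : ℝ) : t • φ.mk4 a b c e = φ.mk4 (t * a) (t * b) (t * c) (t * e) := by
  rw [← mkSt_vel_str (t • φ.mk4 a b c e), vel_smul, str_smul, vel_mk4, str_mk4, mk4]
  congr 1
  · ext i; rcases φ.univ i with rfl | rfl <;> simp
  · ext i j; rcases φ.univ i with rfl | rfl <;> rcases φ.univ j with rfl | rfl <;> simp

/-- `mk4` is subtractive. [folklore] -/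
theorem mk4_sub (a b c e a' b' c' e' : ℝ) :
    φ.mk4 a b c e - φ.mk4 a' b' c' e' = φ.mk4 (a - a') (b - b') (c - c') (e - e') := by
  rw [sub_eq_add_neg, show -φ.mk4 a' b' c' e' = (-1 : ℝ) • φ.mk4 a' b' c' e' by rw [neg_one_smul], smul_mk4, mk4_add]
  congr 1 <;> ring

/-- `mk4` is injective. [folklore] -/
theorem mk4_inj {a b c e a' b' c' e' : ℝ} (h : φ.mk4 a b c e = φ.mk4 a' b' c' e') :
    a = a' ∧ b = b' ∧ c = c' ∧ e = e' := by
  have ha := congrArg φ.ca h; have hb := congrArg φ.cb h; have hc := congrArg φ.cc h; have he := congrArg φ.ce h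
  simp only [ca_mk4, cb_mk4, cc_mk4, ce_mk4] at ha hb hc he
  exact ⟨ha, hb, hc, he⟩

/-- Planar states are admissible. [folklore] -/
theorem isAdm_mk4 (a b c e : ℝ) : IsAdm (φ.mk4 a b c e) := by
  refine ⟨?_, ?_⟩
  · rw [str_mk4]; unfold Matrix.IsSymm; ext i j
    rcases φ.univ i with rfl | rfl <;> rcases φ.univ j with rfl | rfl <;> simp
  · rw [str_mk4, Matrix.trace, φ.sum_eq]; simp

/-- **An admissible planar state is determined by its four coordinates.** [cite: ChoffrutSzekelyhidi2014, §5.1] -/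
theorem eq_mk4 {w : State d} (hw : IsAdm w) : w = φ.mk4 (φ.ca w) (φ.cb w) (φ.cc w) (φ.ce w) := by
  have hsym : w (Sum.inr (φ.i₁, φ.i₀)) = w (Sum.inr (φ.i₀, φ.i₁)) := by
    have h := congrFun (congrFun hw.1 φ.i₀) φ.i₁
    simpa [Matrix.transpose_apply] using h
  have htr : w (Sum.inr (φ.i₁, φ.i₁)) = -w (Sum.inr (φ.i₀, φ.i₀)) := by
    have h := hw.2
    rw [Matrix.trace, φ.sum_eq] at h
    simp only [Matrix.diag_apply, str_apply] at h
    linarith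
  rw [← mkSt_vel_str w, mk4]
  congr 1
  · ext i; rcases φ.univ i with rfl | rfl <;> simp [ca, cb]
  · ext i j
    rcases φ.univ i with rfl | rfl <;> rcases φ.univ j with rfl | rfl <;> simp [cc, ce, hsym, htr]

/-- `|v|² = a² + b²`. [folklore] -/
theorem norm_vec2_sq (a b : ℝ) : ‖φ.vec2 a b‖ ^ 2 = a ^ 2 + b ^ 2 := by
  rw [EuclideanSpace.real_norm_sq_eq, φ.sum_eq, vec2_apply₀, vec2_apply₁]

/-- Inner products of planar vectors. [folklore] -/
theorem inner_vec2 (a b a' b' : ℝ) : ⟪φ.vec2 a b, φ.vec2 a' b'⟫_ℝ = a * a' + b * b' := by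
  rw [PiLp.inner_apply, φ.sum_eq]; simp [mul_comm]

/-- `mat2` acting on `vec2`. [folklore] -/
theorem mat2_mulVec_vec2 (c e x y : ℝ) : φ.mat2 c e *ᵥ (⇑(φ.vec2 x y)) = ⇑(φ.vec2 (c * x + e * y) (e * x - c * y)) := by
  funext i
  simp only [Matrix.mulVec, dotProduct, φ.sum_eq]
  rcases φ.univ i with rfl | rfl <;> simp
  ring

/-- The identity acting on `vec2`. [folklore] -/
theorem smul_one_mulVec_vec2 (q x y : ℝ) : (q • (1 : Matrix d d ℝ)) *ᵥ (⇑(φ.vec2 x y)) = ⇑(φ.vec2 (q * x) (q * y)) := by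
  funext i
  rw [Matrix.smul_mulVec, Matrix.one_mulVec]
  rcases φ.univ i with rfl | rfl <;> simp

/-- `vec2` is injective-ish: `vec2 x y = 0 ↔ x = 0 ∧ y = 0`. [folklore] -/
theorem vec2_eq_zero_iff (x y : ℝ) : φ.vec2 x y = 0 ↔ x = 0 ∧ y = 0 := by
  constructor
  · intro h
    have h0 := congrArg (fun v : Ed d => v φ.i₀) h
    have h1 := congrArg (fun v : Ed d => v φ.i₁) h
    simp only [vec2_apply₀, vec2_apply₁, PiLp.zero_apply] at h0 h1
    exact ⟨h0, h1⟩
  · rintro ⟨rfl, rfl⟩; ext i; rcases φ.univ i with rfl | rfl <;> simp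

/-- `vec2` respects addition. [folklore] -/
theorem vec2_add (a b a' b' : ℝ) : φ.vec2 a b + φ.vec2 a' b' = φ.vec2 (a + a') (b + b') := by
  ext i; rcases φ.univ i with rfl | rfl <;> simp

/-! ## `𝒦_r` and `𝒦_r^{co}` in coordinates -/

/-- **`𝒦_r` in coordinates**: `(a, b, a²-r/2 … )`; precisely `mk4 a b c e ∈ 𝒦_r` if `a² + b² = r`,
`c = (a² - b²)/2`, `e = ab` (`ζ = z²/2`). [cite: ChoffrutSzekelyhidi2014, §5.1] -/
theorem mk4_mem_K {r a b c e : ℝ} (hr : a ^ 2 + b ^ 2 = r) (hc : c = (a ^ 2 - b ^ 2) / 2) (he : e = a * b) :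
    φ.mk4 a b c e ∈ K r := by
  refine ⟨by rw [vel_mk4, norm_vec2_sq, hr], ?_⟩
  rw [vel_mk4, str_mk4, φ.card_eq]
  ext i j
  rw [Matrix.sub_apply, Matrix.smul_apply, Matrix.one_apply]
  rcases φ.univ i with rfl | rfl <;> rcases φ.univ j with rfl | rfl <;>
    simp [tensorSelf, Matrix.vecMulVec_apply, φ.ne, φ.ne'] <;> nlinarith [hr, hc, he]

/-- A `2 × 2` quadratic form with non-negative diagonal and determinant is non-negative. [folklore] -/
theorem quadForm_nonneg {p q s : ℝ} (hp : 0 ≤ p) (hs : 0 ≤ s) (hdet : q ^ 2 ≤ p * s) (x y : ℝ) :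
    0 ≤ p * x ^ 2 + 2 * q * x * y + s * y ^ 2 := by
  rcases hp.lt_or_eq with hp' | hp'
  · have h1 : 0 ≤ (p * x + q * y) ^ 2 + (p * s - q ^ 2) * y ^ 2 := by nlinarith [sq_nonneg (p * x + q * y), sq_nonneg y]
    have h2 : p * (p * x ^ 2 + 2 * q * x * y + s * y ^ 2) = (p * x + q * y) ^ 2 + (p * s - q ^ 2) * y ^ 2 := by ring
    nlinarith
  · have hq2 : q ^ 2 ≤ 0 := by rw [← hp', zero_mul] at hdet; exact hdet
    have hq : q = 0 := pow_eq_zero_iff (n := 2) (by norm_num) |>.1 (le_antisymm hq2 (sq_nonneg q))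
    rw [← hp', hq]
    nlinarith [sq_nonneg y]

/-- **`𝒦_r^{co}` in coordinates (sufficient condition)**: the gap matrix of `mk4 a b c e` is
`[[r/2 + c - a², e - ab], [e - ab, r/2 - c - b²]]`; if its diagonal and determinant are
non-negative, the state lies in `C_r`. [cite: ChoffrutSzekelyhidi2014, (2.5)] -/
theorem mk4_mem_C {r a b c e : ℝ} (h1 : a ^ 2 ≤ r / 2 + c) (h2 : b ^ 2 ≤ r / 2 - c)
    (hdet : (e - a * b) ^ 2 ≤ (r / 2 + c - a ^ 2) * (r / 2 - c - b ^ 2)) : φ.mk4 a b c e ∈ C r := by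
  rw [mem_C_iff]
  refine ⟨φ.isAdm_mk4 a b c e, fun x => ?_⟩
  -- the gap matrix in coordinates
  have hgap : ∀ i j, gap r (φ.mk4 a b c e) i j =
      (if i = φ.i₀ then (if j = φ.i₀ then r / 2 + c - a ^ 2 else e - a * b)
        else (if j = φ.i₀ then e - a * b else r / 2 - c - b ^ 2)) := by
    intro i j
    rw [gap, vel_mk4, str_mk4, φ.card_eq, Matrix.add_apply, Matrix.sub_apply, Matrix.smul_apply, Matrix.one_apply]
    rcases φ.univ i with rfl | rfl <;> rcases φ.univ j with rfl | rfl <;>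
      simp [tensorSelf, Matrix.vecMulVec_apply, φ.ne, φ.ne'] <;> ring
  have g00 : gap r (φ.mk4 a b c e) φ.i₀ φ.i₀ = r / 2 + c - a ^ 2 := by rw [hgap]; simp
  have g01 : gap r (φ.mk4 a b c e) φ.i₀ φ.i₁ = e - a * b := by rw [hgap]; simp [φ.ne']
  have g10 : gap r (φ.mk4 a b c e) φ.i₁ φ.i₀ = e - a * b := by rw [hgap]; simp [φ.ne']
  have g11 : gap r (φ.mk4 a b c e) φ.i₁ φ.i₁ = r / 2 - c - b ^ 2 := by rw [hgap]; simp [φ.ne']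
  have hform : x ⬝ᵥ (gap r (φ.mk4 a b c e) *ᵥ x) =
      (r / 2 + c - a ^ 2) * x φ.i₀ ^ 2 + 2 * (e - a * b) * x φ.i₀ * x φ.i₁ + (r / 2 - c - b ^ 2) * x φ.i₁ ^ 2 := by
    simp only [dotProduct, Matrix.mulVec, φ.sum_eq, g00, g01, g10, g11]
    ring
  rw [hform]
  exact quadForm_nonneg (by linarith) (by linarith) hdet _ _

/-! ## Rotations -/

/-- **The rotation `R_θ`** of (5.1), with `κ = cos θ`, `λ = sin θ`:
`z ↦ z e^{iθ}`, `ζ ↦ ζ e^{2iθ}`. [cite: ChoffrutSzekelyhidi2014, (5.1)] -/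
def rot (κ l a b c e : ℝ) : State d :=
  φ.mk4 (κ * a - l * b) (l * a + κ * b) ((κ ^ 2 - l ^ 2) * c - 2 * κ * l * e) (2 * κ * l * c + (κ ^ 2 - l ^ 2) * e)

/-- Rotations preserve `𝒦_r` (the L-points `(±√r, 0, r/2)` rotate into `𝒦_r`). [cite: ChoffrutSzekelyhidi2014, §5.1] -/
theorem rot_mem_K {κ l : ℝ} (hκl : κ ^ 2 + l ^ 2 = 1) {r a b c e : ℝ} (hr : a ^ 2 + b ^ 2 = r)
    (hc : c = (a ^ 2 - b ^ 2) / 2) (he : e = a * b) : φ.rot κ l a b c e ∈ K r := by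
  refine φ.mk4_mem_K ?_ ?_ ?_
  · nlinarith [hκl, hr]
  · rw [hc, he]; ring
  · rw [hc, he]; ring

/-- Differences of rotated states. [folklore] -/
theorem rot_sub (κ l a b c e a' b' c' e' : ℝ) :
    φ.rot κ l a b c e - φ.rot κ l a' b' c' e' = φ.rot κ l (a - a') (b - b') (c - c') (e - e') := by
  rw [rot, rot, mk4_sub, rot]; congr 1 <;> ring

/-- Convex combinations of rotated states. [folklore] -/
theorem rot_convex (κ l t a b c e a' b' c' e' : ℝ) :
    t • φ.rot κ l a b c e + (1 - t) • φ.rot κ l a' b' c' e' =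
      φ.rot κ l (t * a + (1 - t) * a') (t * b + (1 - t) * b') (t * c + (1 - t) * c') (t * e + (1 - t) * e') := by
  rw [rot, rot, smul_mk4, smul_mk4, mk4_add, rot]; congr 1 <;> ring

/-- Rotated states are admissible. [folklore] -/
theorem isAdm_rot (κ l a b c e : ℝ) : IsAdm (φ.rot κ l a b c e) := φ.isAdm_mk4 _ _ _ _

/-! ## Wave-cone directions (Lemma 13) -/

/-- The rotated unit vectors `R(1,0) = (κ, λ)` and `R(0,1) = (-λ, κ)` are non-zero. [folklore] -/
theorem vec2_ne_zero_of_sq {x y : ℝ} (h : x ^ 2 + y ^ 2 = 1) : φ.vec2 x y ≠ 0 := by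
  intro h0
  rw [vec2_eq_zero_iff] at h0
  rw [h0.1, h0.2] at h; norm_num at h

include φ in
/-- **Horizontal directions are wave directions** (Lemma 13 / (5.4): directions `(ā, b̄, 0)`; here any
state with vanishing stress part): `η = v̄^⊥` (or anything if `v̄ = 0`), `q = 0`.
[cite: ChoffrutSzekelyhidi2014, Lemma 13] -/
theorem isWaveDir_of_str_eq_zero {w : State d} (h : str w = 0) : IsWaveDir w := by
  by_cases hv : vel w = 0
  · refine ⟨φ.vec2 1 0, 0, φ.vec2_ne_zero_of_sq (by norm_num), by rw [hv, inner_zero_left], ?_⟩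
    rw [h, zero_add, zero_smul, Matrix.zero_mulVec]
  · refine ⟨φ.vec2 (vel w φ.i₁) (-vel w φ.i₀), 0, ?_, ?_, by rw [h, zero_add, zero_smul, Matrix.zero_mulVec]⟩
    · intro h0
      rw [vec2_eq_zero_iff] at h0
      apply hv
      ext i
      rcases φ.univ i with rfl | rfl
      · simpa using h0.2
      · simpa using h0.1
    · rw [PiLp.inner_apply, φ.sum_eq]
      simp only [vec2_apply₀, vec2_apply₁, RCLike.inner_apply, conj_trivial]
      ring

/-- Rotated horizontal differences have zero stress. [folklore] -/
theorem str_rot_horizontal (κ l x y : ℝ) : str (φ.rot κ l x y 0 0) = 0 := by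
  rw [rot, str_mk4]
  ext i j
  rcases φ.univ i with rfl | rfl <;> rcases φ.univ j with rfl | rfl <;> simp

/-- `R(0,1) ⊥ R(x, 0)`: the rotated second axis is perpendicular to rotated horizontal-`a` velocities. [folklore] -/
theorem inner_vel_rot_a (κ l x c e : ℝ) : ⟪vel (φ.rot κ l x 0 c e), φ.vec2 (-l) κ⟫_ℝ = 0 := by
  rw [rot, vel_mk4, inner_vec2]; ring

/-- `R(1,0) ⊥ R(0, y)`. [folklore] -/
theorem inner_vel_rot_b (κ l y c e : ℝ) : ⟪vel (φ.rot κ l 0 y c e), φ.vec2 κ l⟫_ℝ = 0 := by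
  rw [rot, vel_mk4, inner_vec2]; ring

/-- `R(y, -x)·… ⊥ R(x, y)`: perpendicular of a general rotated horizontal velocity. [folklore] -/
theorem inner_vel_rot_perp (κ l x y c e : ℝ) :
    ⟪vel (φ.rot κ l x y c e), φ.vec2 (κ * (-y) - l * x) (l * (-y) + κ * x)⟫_ℝ = 0 := by
  rw [rot, vel_mk4, inner_vec2]; ring

/-- **The direction `(s, 0, ρ)` (e.g. `(σ√r, 0, r)` of (5.5)) is a wave direction**: rotated,
`η = R(0,1)`, `q = ρ`. [cite: ChoffrutSzekelyhidi2014, Lemma 13, (5.5)] -/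
theorem mulVec_rot_a {κ l : ℝ} (hκl : κ ^ 2 + l ^ 2 = 1) (s ρ : ℝ) :
    (str (φ.rot κ l s 0 ρ 0) + ρ • (1 : Matrix d d ℝ)) *ᵥ (⇑(φ.vec2 (-l) κ)) = 0 := by
  rw [rot, str_mk4, Matrix.add_mulVec, mat2_mulVec_vec2, smul_one_mulVec_vec2]
  rw [show (⇑(φ.vec2 (((κ ^ 2 - l ^ 2) * ρ - 2 * κ * l * 0) * -l + (2 * κ * l * ρ + (κ ^ 2 - l ^ 2) * 0) * κ)
      ((2 * κ * l * ρ + (κ ^ 2 - l ^ 2) * 0) * -l - ((κ ^ 2 - l ^ 2) * ρ - 2 * κ * l * 0) * κ)) : d → ℝ) +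
      ⇑(φ.vec2 (ρ * -l) (ρ * κ)) = ⇑(φ.vec2 0 0) from ?_]
  · funext i; rcases φ.univ i with rfl | rfl <;> simp
  · funext i
    simp only [Pi.add_apply]
    rcases φ.univ i with rfl | rfl
    · simp only [vec2_apply₀]; linear_combination ρ * l * hκl
    · simp only [vec2_apply₁]; linear_combination (-(ρ * κ)) * hκl

/-- **The direction `(0, s, ρ)` (e.g. `(0, σ√r, -r)` of (5.6)) is a wave direction**: rotated,
`η = R(1,0)`, `q = -ρ`. [cite: ChoffrutSzekelyhidi2014, Lemma 13, (5.6)] -/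
theorem mulVec_rot_b {κ l : ℝ} (hκl : κ ^ 2 + l ^ 2 = 1) (s ρ : ℝ) :
    (str (φ.rot κ l 0 s ρ 0) + (-ρ) • (1 : Matrix d d ℝ)) *ᵥ (⇑(φ.vec2 κ l)) = 0 := by
  rw [rot, str_mk4, Matrix.add_mulVec, mat2_mulVec_vec2, smul_one_mulVec_vec2]
  funext i
  simp only [Pi.add_apply, Pi.zero_apply]
  rcases φ.univ i with rfl | rfl
  · simp only [vec2_apply₀]; linear_combination ρ * κ * hκl
  · simp only [vec2_apply₁]; linear_combination ρ * l * hκl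

/-- Horizontal rotated differences: the stress condition holds with `q = 0` for any `η`. [folklore] -/
theorem mulVec_rot_horizontal (κ l x y : ℝ) (η : Ed d) :
    (str (φ.rot κ l x y 0 0) + (0 : ℝ) • (1 : Matrix d d ℝ)) *ᵥ (⇑η) = 0 := by
  rw [str_rot_horizontal, zero_add, zero_smul, Matrix.zero_mulVec]

/-- **Vertical directions `(0, 0, s)` (pure stress, `v̄ = 0`) are wave directions** (used to see
that `L`-points with `c = 0` lie in `𝒱_r^{(1)}`): `η = R(1,0)`, `q = -s`. [cite: ChoffrutSzekelyhidi2014, (5.4)] -/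
theorem isWaveDir_rot_vert {κ l : ℝ} (hκl : κ ^ 2 + l ^ 2 = 1) (s : ℝ) : IsWaveDir (φ.rot κ l 0 0 s 0) := by
  refine ⟨φ.vec2 κ l, -s, φ.vec2_ne_zero_of_sq hκl, ?_, φ.mulVec_rot_b hκl 0 s⟩
  rw [rot, vel_mk4, inner_vec2]; ring

end Frame2

end StationaryEuler

end Literature.Analysis.FluidPDE
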